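import Summits.BirchSwinnertonDyer.BirchSwinnertonDyer.Theorems.QuadraticBranchSignedControlPlusEtaNonsurjTwistedCongruenceTrace
import Summits.BirchSwinnertonDyer.Rank1Residual.Supersingular.TwistStability
import Summits.BirchSwinnertonDyer.Rank1Residual.AdditivePotMult.TwistSupply
import Summits.BirchSwinnertonDyer.Rank1Residual.GaloisImage.JWitnessTowerSurjectivity
import Literature.NumberTheory.EllipticCurves.HeegnerPointsKolyvaginExceptionalTwistProofs
import Literature.NumberTheory.EllipticCurves.QuadraticTwistKroneckerLFunctionProofs
import Literature.NumberTheory.EllipticCurves.ComplexMultiplicationShaKnappProofs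
import Literature.NumberTheory.EllipticCurves.ZywinaCMImageProofs
import Summits.BirchSwinnertonDyer.Rank1Residual.GaloisImage.TorsionIsoImageObstruction
import HarnessLib

/-!
# Route `QuadraticBranchSignedControl` (rung K8, cell `bsd-potss`): crux stmt-BirchSwinnertonDyer-19606
# `PlusEtaMainConjectureNonsurj` — THE LOCUS OF `stub_etaMC_nonCM_uncongruent` IS CLOSED UNDER THE QUADRATIC TWISTS UNRAMIFIED AT `p`
# (mod-`p` congruence is transported along a common twist; rows go to rows; «no CM anchor» goes to «no CM anchor»)

WHY. The per-row kernel records of the v7 stub `stub_etaMC_nonCM_uncongruent` (k8eta-c2 g14 at `p = 5`: `…UncongruentRecords01–44`,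
`…RecordsFine01–04`; this seat at `p = 7`: `…UncongruentRecordsSeven01…`) certify ONE curve per `j`-invariant (the minimal twist),
while the crux's rows with a given `j ∉ {0, 1728}` are all the globally minimal models of the quadratic twists `V^{(d)}` that are again
good at `p` — the twists by square-free `d` with `p ∤ 2d`. This file proves, in the kernel and with no displayed input, that along such
a twist (i) the row conditions are preserved (good at `p`: `Supersingular.hasGoodReductionAtPrime_of_smul_eq_quadraticTwist`; `a_p = 0`:
`a_p(V') = (d/p)·a_p(V)`, `frobeniusTrace_of_smul_eq_quadraticTwist`; tower not onto: `GaloisImage.hasSurjectiveModNGaloisRep_pow_iff_of_model_twist`),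
and (ii) the conclusion «no globally minimal CM curve good at `p` with `a_p = 0` is `p`-congruent to the row» is preserved — because a
mod-`p` congruence `X[p] ≅ Y[p]` is TRANSPORTED to the twists `X'[p] ≅ Y'[p]` of both sides by the same `d` (§2: the two twisting
isomorphisms are `Γ_ℚ`-equivariant up to the SAME Kummer sign of `√d`, which cancels), and the twist of a CM anchor by `d` has a globally
minimal model which is again CM, good at `p`, with `a_p = 0`. So each record decides the stub's locus for the whole twist class of its row.

* §1 `exists_kummerTwistedTorsionIso_of_smul_eq_quadraticTwist` — `C • X' = X^{(d)}` gives `X'[n] ≃+ X[n]`, equivariant up to the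
  Kummer sign of `√d` (`twistPointsIso`, `quadraticTwist_smul`, `untwistEquiv` on the normal form `toCharNeTwoNF • X`, `geomPointsEquiv`).
* §2 `modPCongruent_of_smul_eq_quadraticTwist` — `X[p] ≅ Y[p]` ⟹ `X'[p] ≅ Y'[p]` for models `X'`, `Y'` of `X^{(d)}`, `Y^{(d)}`.
* §3 `row_of_smul_eq_quadraticTwist` — the row hypotheses of crux 19606 pass to the twist (`d` square-free, `p ∤ 2d`).
* §4 **`not_exists_cmAnchor_of_smul_eq_quadraticTwist`** — the negated existential of `Sig.stub_etaMC_nonCM_uncongruent` passes from `V`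
  to every globally minimal `V'` with `C • V' = V^{(d)}`, `d` square-free, `p ∤ 2d`; `…_iff_…` both ways.
* §5 (APPENDED) `exists_squarefree_twist_of_j_eq_of_good` — two curves good at `p ≠ 2` with the same `j ∉ {0, 1728}` are twists of each
  other by a square-free `d` with `p ∤ 2d` (Silverman X.5.4 + «`p ∣ d` ⟹ `V^{(d)}` additive at `p`»); hence
  **`not_exists_cmAnchor_iff_of_j_eq`**: on the rows of crux 19606 the negated existential of `Sig.stub_etaMC_nonCM_uncongruent` DEPENDS
  ONLY ON `j` (for `j ∉ {0, 1728}`) — one record per `j` decides every row with that `j`.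
* §6 (APPENDED) on the NON-CM rows — the domain of the stub — the hypothesis `j ∉ {0, 1728}` is automatic (`0`, `1728` are CM
  `j`-invariants): `not_exists_cmAnchor_iff_of_j_eq_of_not_hasCM`, `row_of_j_eq_of_not_hasCM`.
* §7 (APPENDED) complement on the OTHER population: a curve `p`-congruent to a CM curve (`p` odd) is never tower-onto
  (`not_forall_hasSurjectiveModNGaloisRep_pow_of_cmCongruent`) — on the CM-transfer branch the row hypothesis «tower not onto» follows from the
  congruence itself (kernel congruences at `p = 5`: g8's `EtaModFiveCongruenceRecords.modPCongruent_twist5_*`).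
* §8 (APPENDED) `not_hasCM_of_not_exists_cmAnchor` — a globally minimal curve good at `p` with `a_p = 0` satisfying the stub's negated existential
  is NOT CM (it would be its own anchor: `ModPCongruent` is reflexive): every record `uncongruent_<t>` / `uncongruent7_<x>` / `uncongruent11_<n>`
  places its curve in the stub's DOMAIN (non-CM) as well as in its locus.

HONEST FRAMING (cell `bsd-potss`, run/shared/lean/pub/bsd-potss/; FULL-BSD rank ≤ 1 programme): TOOL THEOREMS ONLY (no definition,
no named fact, no `sorry`, axioms standard). Nothing is booked; crux 19606 stays OPEN; (C1⁺_η) is proved for no row; `BSD(W, p)` is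
claimed for no pair. Seat `bsd-potss-k8eta-c2` g15 (prover), `--supports stmt-BirchSwinnertonDyer-19606`.

References: [SilvermanAEC2009] X.5 Prop. 5.4, Cor. 5.4.1, III.§7, VII.5 Prop. 5.1; [Knapp1993] Prop. 12.10; [Serre1972] §4.5.
-/

set_option autoImplicit false
set_option linter.dupNamespace false

noncomputable section

open scoped Classical NumberField

open Field IsDedekindDomain NumberField WeierstrassCurve Literature.NumberTheory.EllipticCurves
  Literature.NumberTheory.GaloisRepresentations Rat.HeightOneSpectrum
open Summit.BirchSwinnertonDyer.Rank1Residual.O6 (ModPCongruent)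
open Summit.BirchSwinnertonDyer.Rank1Residual (Supersingular.exists_smul_eq_quadraticTwist_symm
  Supersingular.hasGoodReductionAtPrime_of_smul_eq_quadraticTwist Supersingular.frobeniusTrace_of_smul_eq_quadraticTwist
  GaloisImage.hasSurjectiveModNGaloisRep_pow_iff_of_model_twist AdditivePotMult.exists_globallyMinimal_model_twist)

namespace Summit.BirchSwinnertonDyer.BirchSwinnertonDyer.Theorems.EtaCartanField

/-! ## §1 A model of a quadratic twist: the Kummer-twisted isomorphism on torsion -/

/-- **`C • X' = X^{(d)}` (`d ≠ 0`) gives an additive isomorphism `X'[n] ≃+ X[n]` which is `Γ_ℚ`-equivariant up to the Kummer sign of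
`√d`** (the `ℚ`-isomorphism `twistPointsIso`, the variable change to the normal form `X₀ = toCharNeTwoNF • X` (`quadraticTwist_smul`),
the twisting isomorphism `untwistEquiv : X₀^{(d)}(ℚ̄) ≃ X₀(ℚ̄)` over `ℚ(√d)`, and `X₀ ≅ X`; restricted to the `n`-torsion).
[cite: SilvermanAEC2009, X.5 Prop. 5.4 and III.§7] -/
theorem exists_kummerTwistedTorsionIso_of_smul_eq_quadraticTwist {X X' : WeierstrassCurve ℚ} [X.IsElliptic] {d : ℚ}
    (hd : d ≠ 0) {C : VariableChange ℚ} (hC : C • X' = X.quadraticTwist d) (n : ℤ) :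
    ∃ e : X'.geomTorsion n ≃+ X.geomTorsion n,
      (∀ σ : absoluteGaloisGroup ℚ, σ • geomSqrt d = geomSqrt d → ∀ P : X'.geomTorsion n, e (σ • P) = σ • e P) ∧
      (∀ σ : absoluteGaloisGroup ℚ, σ • geomSqrt d = -geomSqrt d → ∀ P : X'.geomTorsion n, e (σ • P) = -(σ • e P)) := by
  letI : Invertible (2 : ℚ) := invertibleOfNonzero two_ne_zero
  set C₀ : VariableChange ℚ := X.toCharNeTwoNF with hC₀
  -- `X₀ = C₀ • X` and `C₁ • X' = X₀^{(d)}`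
  have hC₁ : ((⟨C₀.u, d * C₀.r, 0, 0⟩ : VariableChange ℚ) * C) • X' = (C₀ • X).quadraticTwist d := by
    rw [mul_smul, hC, quadraticTwist_smul]
  -- the sign function
  let s : absoluteGaloisGroup ℚ → ℤ := fun σ => if σ • geomSqrt d = geomSqrt d then 1 else -1
  have hs1 : ∀ σ : absoluteGaloisGroup ℚ, σ • geomSqrt d = geomSqrt d → s σ = 1 := fun σ h => if_pos h
  have hs2 : ∀ σ : absoluteGaloisGroup ℚ, σ • geomSqrt d = -geomSqrt d → s σ = -1 := fun σ h => by
    have h' : ¬ σ • geomSqrt d = geomSqrt d := by rw [h]; exact fun h'' => geomSqrt_ne_neg hd h''.symm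
    exact if_neg h'
  let E₁ : X'.geomPoints ≃+ ((C₀ • X).quadraticTwist d).geomPoints := twistPointsIso hC₁
  let E₂ : ((C₀ • X).quadraticTwist d).geomPoints ≃+ (C₀ • X).geomPoints := untwistEquiv (C₀ • X) hd
  let E₃ : (C₀ • X).geomPoints ≃+ X.geomPoints := (geomPointsEquiv X C₀).symm
  have hE₃ : ∀ (σ : absoluteGaloisGroup ℚ) (Q : (C₀ • X).geomPoints), E₃ (σ • Q) = σ • E₃ Q := fun σ Q => by
    apply (geomPointsEquiv X C₀).injective
    change (geomPointsEquiv X C₀) ((geomPointsEquiv X C₀).symm (σ • Q)) = _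
    rw [AddEquiv.apply_symm_apply, geomPointsEquiv_smul, AddEquiv.apply_symm_apply]
  let E : X'.geomPoints ≃+ X.geomPoints := E₁.trans (E₂.trans E₃)
  have hE : ∀ (σ : absoluteGaloisGroup ℚ) (P : X'.geomPoints), E (σ • P) = s σ • σ • E P := fun σ P => by
    change E₃ (E₂ (E₁ (σ • P))) = s σ • σ • E₃ (E₂ (E₁ P))
    rw [show E₁ (σ • P) = σ • E₁ P from twistPointsIso_smul hC₁ σ P]
    rcases smul_geomSqrt_eq_or σ d with hσ | hσ
    · rw [show E₂ (σ • E₁ P) = σ • E₂ (E₁ P) from untwistEquiv_smul_of_eq (C₀ • X) hd σ hσ _, hE₃, hs1 σ hσ, one_zsmul]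
    · rw [show E₂ (σ • E₁ P) = -(σ • E₂ (E₁ P)) from untwistEquiv_smul_of_eq_neg (C₀ • X) hd σ hσ _, map_neg, hE₃,
        hs2 σ hσ, neg_one_zsmul]
  obtain ⟨e, he⟩ := exists_torsionIso_of_addEquiv E s hE n
  exact ⟨e, fun σ hσ P => by rw [he, hs1 σ hσ, one_zsmul], fun σ hσ P => by rw [he, hs2 σ hσ, neg_one_zsmul]⟩

/-! ## §2 Mod-`p` congruence is transported along a common quadratic twist -/

/-- **Transport of mod-`p` congruence along a common twist.** If `X[p] ≅ Y[p]` as `Γ_ℚ`-modules (`ModPCongruent X Y p`) and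
`C • X' = X^{(d)}`, `C' • Y' = Y^{(d)}` (`d ≠ 0`), then `X'[p] ≅ Y'[p]`: compose the two Kummer-twisted isomorphisms of §1 with the
congruence — the signs `±1` of `σ` on `√d` agree on both sides and cancel. [cite: SilvermanAEC2009, X.5 Prop. 5.4 and III.§7] -/
theorem modPCongruent_of_smul_eq_quadraticTwist {X Y X' Y' : WeierstrassCurve ℚ} [X.IsElliptic] [Y.IsElliptic] {p : ℕ} {d : ℚ}
    (hd : d ≠ 0) {C : VariableChange ℚ} (hC : C • X' = X.quadraticTwist d) {C' : VariableChange ℚ}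
    (hC' : C' • Y' = Y.quadraticTwist d) (h : ModPCongruent X Y p) : ModPCongruent X' Y' p := by
  obtain ⟨eX, hXp, hXm⟩ := exists_kummerTwistedTorsionIso_of_smul_eq_quadraticTwist hd hC (p : ℤ)
  obtain ⟨eY, hYp, hYm⟩ := exists_kummerTwistedTorsionIso_of_smul_eq_quadraticTwist hd hC' (p : ℤ)
  obtain ⟨e, he⟩ := h
  refine ⟨eX.trans (e.trans eY.symm), fun σ P => ?_⟩
  apply eY.injective
  rw [AddEquiv.trans_apply, AddEquiv.trans_apply, AddEquiv.apply_symm_apply, AddEquiv.trans_apply, AddEquiv.trans_apply]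
  rcases smul_geomSqrt_eq_or σ d with hσ | hσ
  · rw [hXp σ hσ, he, hYp σ hσ, AddEquiv.apply_symm_apply]
  · rw [hXm σ hσ, map_neg, he, hYm σ hσ, AddEquiv.apply_symm_apply]

/-- Symmetric form: the congruence transported to the twists, both ways (the twist relation is symmetric up to `ℚ`-isomorphism,
`Supersingular.exists_smul_eq_quadraticTwist_symm`). [cite: SilvermanAEC2009, X.5 Cor. 5.4] -/
theorem modPCongruent_iff_of_smul_eq_quadraticTwist {X Y X' Y' : WeierstrassCurve ℚ} [X.IsElliptic] [Y.IsElliptic]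
    [X'.IsElliptic] [Y'.IsElliptic] {p : ℕ} {d : ℚ} (hd : d ≠ 0) {C : VariableChange ℚ} (hC : C • X' = X.quadraticTwist d)
    {C' : VariableChange ℚ} (hC' : C' • Y' = Y.quadraticTwist d) : ModPCongruent X Y p ↔ ModPCongruent X' Y' p := by
  refine ⟨modPCongruent_of_smul_eq_quadraticTwist hd hC hC', fun h => ?_⟩
  obtain ⟨D, hD⟩ := Supersingular.exists_smul_eq_quadraticTwist_symm X X' hd hC
  obtain ⟨D', hD'⟩ := Supersingular.exists_smul_eq_quadraticTwist_symm Y Y' hd hC'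
  exact modPCongruent_of_smul_eq_quadraticTwist hd hD hD' h

/-! ## §3 The row conditions of crux 19606 pass to the twists unramified at `p` -/

/-- **Rows go to rows.** If `V` is a row of crux 19606 at `p` (globally minimal, good at `p`, `a_p = 0`, `p`-adic tower not onto) and
`V'` is a globally minimal model of `V^{(d)}` with `d` square-free and `p ∤ 2d`, then `V'` is a row: good at `p`
(`Supersingular.hasGoodReductionAtPrime_of_smul_eq_quadraticTwist`), `a_p(V') = (d/p)·a_p(V) = 0`
(`Supersingular.frobeniusTrace_of_smul_eq_quadraticTwist`), tower not onto (`GaloisImage.hasSurjectiveModNGaloisRep_pow_iff_of_model_twist`).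
[cite: SilvermanAEC2009, VII.5 Prop. 5.1 and X.5 Cor. 5.4] [cite: Knapp1993, Prop. 12.10] -/
theorem row_of_smul_eq_quadraticTwist (V V' : WeierstrassCurve ℚ) [V.IsElliptic] [V.IsGloballyMinimal] [V'.IsElliptic]
    [V'.IsGloballyMinimal] (p : ℕ) [Fact p.Prime] {d : ℤ} (hd : Squarefree d) (hp2d : ¬ (p : ℤ) ∣ 2 * d)
    {C : VariableChange ℚ} (hC : C • V' = V.quadraticTwist (d : ℚ))
    (hgood : V.HasGoodReductionAtPrime p) (hap : V.frobeniusTrace p = 0)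
    (hns : ¬ ∀ m : ℕ, V.HasSurjectiveModNGaloisRep (p ^ m : ℕ)) :
    V'.HasGoodReductionAtPrime p ∧ V'.frobeniusTrace p = 0 ∧ ¬ ∀ m : ℕ, V'.HasSurjectiveModNGaloisRep (p ^ m : ℕ) := by
  have hd0 : (d : ℚ) ≠ 0 := by exact_mod_cast hd.ne_zero
  refine ⟨Supersingular.hasGoodReductionAtPrime_of_smul_eq_quadraticTwist V V' p hC hp2d hgood, ?_, fun h => hns fun m => ?_⟩
  · rw [Supersingular.frobeniusTrace_of_smul_eq_quadraticTwist V V' p hd hC hp2d hgood, hap, mul_zero]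
  · have hC' : C⁻¹ • V.quadraticTwist (d : ℚ) = V' := by rw [← hC, inv_smul_smul]
    exact (GaloisImage.hasSurjectiveModNGaloisRep_pow_iff_of_model_twist V p hd0 ⟨C⁻¹, hC'⟩ m).mp (h m)

/-! ## §4 «No CM anchor» passes to the twists unramified at `p` -/

/-- **The locus of `stub_etaMC_nonCM_uncongruent` is closed under the quadratic twists unramified at `p`.** Let `p` be a prime, `d` a
square-free integer with `p ∤ 2d`, and `C • V' = V^{(d)}` with `V'` globally minimal. If NO globally minimal CM curve good at `p` with
`a_p = 0` is `p`-congruent to `V`, then the same holds for `V'`: a CM anchor `A'` of `V'` would give, by a globally minimal model `A''` of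
`A'^{(d)}` (`AdditivePotMult.exists_globallyMinimal_model_twist`; CM by `hasCM_quadraticTwist`/`hasCM_variableChange`, good at `p` and
`a_p(A'') = (d/p)·0 = 0` by `Supersingular.…`), a CM anchor `A''` of `V` (§2 transport along the common twist by `d`, using the symmetric twist
relation `C'' • V = V'^{(d)}`). [cite: SilvermanAEC2009, X.5 Prop. 5.4, Cor. 5.4.1, VII.5 Prop. 5.1] [cite: Knapp1993, Prop. 12.10] -/
theorem not_exists_cmAnchor_of_smul_eq_quadraticTwist (V V' : WeierstrassCurve ℚ) [V.IsElliptic] [V.IsGloballyMinimal]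
    [V'.IsElliptic] [V'.IsGloballyMinimal] (p : ℕ) [Fact p.Prime] {d : ℤ} (hd : Squarefree d) (hp2d : ¬ (p : ℤ) ∣ 2 * d)
    {C : VariableChange ℚ} (hC : C • V' = V.quadraticTwist (d : ℚ))
    (hV : ¬ ∃ (A : WeierstrassCurve ℚ) (_ : A.IsElliptic) (_ : A.IsGloballyMinimal),
        A.HasCM ∧ A.HasGoodReductionAtPrime p ∧ A.frobeniusTrace p = 0 ∧ ModPCongruent A V p) :
    ¬ ∃ (A : WeierstrassCurve ℚ) (_ : A.IsElliptic) (_ : A.IsGloballyMinimal),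
        A.HasCM ∧ A.HasGoodReductionAtPrime p ∧ A.frobeniusTrace p = 0 ∧ ModPCongruent A V' p := by
  rintro ⟨A', hA'e, hA'm, hCM, hgoodA, hapA, hA'V'⟩
  have hd0 : (d : ℚ) ≠ 0 := by exact_mod_cast hd.ne_zero
  -- a globally minimal model `A''` of the twist `A'^{(d)}`
  obtain ⟨A'', hA''e, hA''m, CA, hCA⟩ := AdditivePotMult.exists_globallyMinimal_model_twist A' hd0
  have hCA' : CA⁻¹ • A'' = A'.quadraticTwist (d : ℚ) := by rw [← hCA, inv_smul_smul]
  -- the symmetric twist relation for the rows: `C'' • V = V'^{(d)}`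
  obtain ⟨C'', hC''⟩ := Supersingular.exists_smul_eq_quadraticTwist_symm V V' hd0 hC
  haveI := A'.isElliptic_quadraticTwist hd0
  refine hV ⟨A'', hA''e, hA''m, ?_, ?_, ?_, ?_⟩
  · rw [← hCA]
    exact hasCM_variableChange _ CA (hasCM_quadraticTwist A' hd0 hCM)
  · exact Supersingular.hasGoodReductionAtPrime_of_smul_eq_quadraticTwist A' A'' p hCA' hp2d hgoodA
  · rw [Supersingular.frobeniusTrace_of_smul_eq_quadraticTwist A' A'' p hd hCA' hp2d hgoodA, hapA, mul_zero]
  · exact modPCongruent_of_smul_eq_quadraticTwist hd0 hCA' hC'' hA'V'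

/-- **Both ways**: for `C • V' = V^{(d)}` (`d` square-free, `p ∤ 2d`, both globally minimal) the negated existential of
`Sig.stub_etaMC_nonCM_uncongruent` holds for `V` iff it holds for `V'` — each kernel record of the stub's locus decides the whole class of
quadratic twists unramified at `p` of its row (all of them rows, §3). [cite: SilvermanAEC2009, X.5 Cor. 5.4 and Cor. 5.4.1] -/
theorem not_exists_cmAnchor_iff_of_smul_eq_quadraticTwist (V V' : WeierstrassCurve ℚ) [V.IsElliptic] [V.IsGloballyMinimal]
    [V'.IsElliptic] [V'.IsGloballyMinimal] (p : ℕ) [Fact p.Prime] {d : ℤ} (hd : Squarefree d) (hp2d : ¬ (p : ℤ) ∣ 2 * d)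
    {C : VariableChange ℚ} (hC : C • V' = V.quadraticTwist (d : ℚ)) :
    (¬ ∃ (A : WeierstrassCurve ℚ) (_ : A.IsElliptic) (_ : A.IsGloballyMinimal),
        A.HasCM ∧ A.HasGoodReductionAtPrime p ∧ A.frobeniusTrace p = 0 ∧ ModPCongruent A V p) ↔
    ¬ ∃ (A : WeierstrassCurve ℚ) (_ : A.IsElliptic) (_ : A.IsGloballyMinimal),
        A.HasCM ∧ A.HasGoodReductionAtPrime p ∧ A.frobeniusTrace p = 0 ∧ ModPCongruent A V' p := by
  have hd0 : (d : ℚ) ≠ 0 := by exact_mod_cast hd.ne_zero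
  obtain ⟨C'', hC''⟩ := Supersingular.exists_smul_eq_quadraticTwist_symm V V' hd0 hC
  exact ⟨not_exists_cmAnchor_of_smul_eq_quadraticTwist V V' p hd hp2d hC,
    not_exists_cmAnchor_of_smul_eq_quadraticTwist V' V p hd hp2d hC''⟩

/-! ## §5 (appended, k8eta-c2 g15) Rows with the same `j`-invariant, `j ∉ {0, 1728}` -/

/-- **Two curves good at a prime `p ≠ 2` with the same `j ∉ {0, 1728}` differ by a quadratic twist UNRAMIFIED at `p`.** By Silverman
X.5.4, `C • V' = V^{(d)}` for a square-free integer `d` (`exists_variableChange_eq_quadraticTwist_intCast_of_j_eq`); if `p ∣ d` then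
`V^{(d)}`, hence its `ℚ`-isomorphic model `V'`, has ADDITIVE reduction at `p` (`hasAdditiveReductionAt_quadraticTwist_of_dvd`,
`hasAdditiveReductionAt_smul_iff`), contradicting the good reduction of `V'` at `p`; and `p ∤ 2`.
[cite: SilvermanAEC2009, X.5 Prop. 5.4, VII.1 Remark 1.1 and VII.5 Prop. 5.1 (c)] -/
theorem exists_squarefree_twist_of_j_eq_of_good (V V' : WeierstrassCurve ℚ) [V.IsElliptic] [V.IsGloballyMinimal] [V'.IsElliptic]
    [V'.IsGloballyMinimal] (p : ℕ) [Fact p.Prime] (hp2 : p ≠ 2) (hj : V'.j = V.j) (h0 : V.j ≠ 0) (h1728 : V.j ≠ 1728)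
    (hgood : V.HasGoodReductionAtPrime p) (hgood' : V'.HasGoodReductionAtPrime p) :
    ∃ d : ℤ, Squarefree d ∧ ¬ (p : ℤ) ∣ 2 * d ∧ ∃ C : VariableChange ℚ, C • V' = V.quadraticTwist (d : ℚ) := by
  obtain ⟨d, hd0, hsq, C, hC⟩ := exists_variableChange_eq_quadraticTwist_intCast_of_j_eq (W := V') (E := V) hj h0 h1728
  refine ⟨d, hsq, fun hpd => ?_, C, hC⟩
  have hpP : p.Prime := Fact.out
  have hpZ : Prime (p : ℤ) := Nat.prime_iff_prime_int.mp hpP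
  -- `p ∣ d` (as `p ∤ 2`)
  have hpd' : (p : ℤ) ∣ d := by
    rcases hpZ.dvd_or_dvd hpd with h2 | h
    · exfalso
      have h2' : p ∣ 2 := by exact_mod_cast h2
      exact hp2 ((Nat.prime_dvd_prime_iff_eq hpP Nat.prime_two).mp h2')
    · exact h
  have hp2d : ¬ (p : ℤ) ^ 2 ∣ d := fun h => hpZ.not_unit (hsq _ (by rw [← pow_two]; exact h))
  -- the place of `ℚ` at `p`
  obtain ⟨v, hv⟩ : ∃ v : HeightOneSpectrum (𝓞 ℚ), (primesEquiv v : ℕ) = p :=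
    ⟨primesEquiv.symm ⟨p, hpP⟩, by rw [Equiv.apply_symm_apply]⟩
  subst hv
  have hgoodv : V.HasGoodReductionAt v := (hasGoodReductionAtPrime_iff_hasGoodReductionAt_ringOfIntegers v V).mp hgood
  have hgoodv' : V'.HasGoodReductionAt v := (hasGoodReductionAtPrime_iff_hasGoodReductionAt_ringOfIntegers v V').mp hgood'
  have hd0' : (d : ℚ) ≠ 0 := by exact_mod_cast hd0
  haveI := V.isElliptic_quadraticTwist hd0'
  have hadd : (V.quadraticTwist (d : ℚ)).HasAdditiveReductionAt v :=
    V.hasAdditiveReductionAt_quadraticTwist_of_dvd v hp2 hd0 hpd' hp2d hgoodv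
  have hC' : C⁻¹ • V.quadraticTwist (d : ℚ) = V' := by rw [← hC, inv_smul_smul]
  have hadd' : V'.HasAdditiveReductionAt v := by
    have h := (hasAdditiveReductionAt_smul_iff_holds v (V.quadraticTwist (d : ℚ)) C⁻¹).mpr hadd
    rwa [hC'] at h
  exact hadd'.not_hasGoodReductionAt hgoodv'

/-- **On the rows of crux 19606, «no CM anchor» depends only on `j` (`j ∉ {0, 1728}`).** For `V`, `V'` globally minimal, both good at the
prime `p ≠ 2`, with `j(V') = j(V) ∉ {0, 1728}`: NO globally minimal CM curve good at `p` with `a_p = 0` is `p`-congruent to `V` iff the same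
holds for `V'` (§5 first theorem + §4). So each kernel record `uncongruent_<t>` / `uncongruent7_<x>` of the stub's locus (one curve per
`j`) decides EVERY row with that `j`. [cite: SilvermanAEC2009, X.5 Prop. 5.4 and Cor. 5.4.1, VII.5 Prop. 5.1] -/
theorem not_exists_cmAnchor_iff_of_j_eq (V V' : WeierstrassCurve ℚ) [V.IsElliptic] [V.IsGloballyMinimal] [V'.IsElliptic]
    [V'.IsGloballyMinimal] (p : ℕ) [Fact p.Prime] (hp2 : p ≠ 2) (hj : V'.j = V.j) (h0 : V.j ≠ 0) (h1728 : V.j ≠ 1728)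
    (hgood : V.HasGoodReductionAtPrime p) (hgood' : V'.HasGoodReductionAtPrime p) :
    (¬ ∃ (A : WeierstrassCurve ℚ) (_ : A.IsElliptic) (_ : A.IsGloballyMinimal),
        A.HasCM ∧ A.HasGoodReductionAtPrime p ∧ A.frobeniusTrace p = 0 ∧ ModPCongruent A V p) ↔
    ¬ ∃ (A : WeierstrassCurve ℚ) (_ : A.IsElliptic) (_ : A.IsGloballyMinimal),
        A.HasCM ∧ A.HasGoodReductionAtPrime p ∧ A.frobeniusTrace p = 0 ∧ ModPCongruent A V' p := by
  obtain ⟨d, hsq, hp2d, C, hC⟩ := exists_squarefree_twist_of_j_eq_of_good V V' p hp2 hj h0 h1728 hgood hgood'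
  exact not_exists_cmAnchor_iff_of_smul_eq_quadraticTwist V V' p hsq hp2d hC

/-- **Row transport by `j`.** If `V` is a row of crux 19606 at a prime `p ≠ 2` (good at `p`, `a_p = 0`, `p`-adic tower not onto) and `V'` is
globally minimal, good at `p`, with `j(V') = j(V) ∉ {0, 1728}`, then `V'` is a row too (`a_p(V') = 0`, tower not onto) — §5 + §3.
[cite: SilvermanAEC2009, X.5 Prop. 5.4, VII.5 Prop. 5.1] [cite: Knapp1993, Prop. 12.10] -/
theorem row_of_j_eq (V V' : WeierstrassCurve ℚ) [V.IsElliptic] [V.IsGloballyMinimal] [V'.IsElliptic] [V'.IsGloballyMinimal]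
    (p : ℕ) [Fact p.Prime] (hp2 : p ≠ 2) (hj : V'.j = V.j) (h0 : V.j ≠ 0) (h1728 : V.j ≠ 1728)
    (hgood : V.HasGoodReductionAtPrime p) (hgood' : V'.HasGoodReductionAtPrime p) (hap : V.frobeniusTrace p = 0)
    (hns : ¬ ∀ m : ℕ, V.HasSurjectiveModNGaloisRep (p ^ m : ℕ)) :
    V'.frobeniusTrace p = 0 ∧ ¬ ∀ m : ℕ, V'.HasSurjectiveModNGaloisRep (p ^ m : ℕ) := by
  obtain ⟨d, hsq, hp2d, C, hC⟩ := exists_squarefree_twist_of_j_eq_of_good V V' p hp2 hj h0 h1728 hgood hgood'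
  exact (row_of_smul_eq_quadraticTwist V V' p hsq hp2d hC hgood hap hns).2

/-! ## §6 (appended, k8eta-c2 g15) Non-CM rows: the hypothesis `j ∉ {0, 1728}` is automatic -/

/-- A non-CM elliptic curve over `ℚ` has `j ≠ 0` and `j ≠ 1728` (both are CM `j`-invariants, `hasCM_iff_j_mem_holds`).
[cite: SilvermanAdvancedTopics1994, App. A §3] -/
theorem j_ne_zero_and_ne_1728_of_not_hasCM (V : WeierstrassCurve ℚ) [V.IsElliptic] (hV : ¬ V.HasCM) :
    V.j ≠ 0 ∧ V.j ≠ 1728 := by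
  refine ⟨fun h => hV ((hasCM_iff_j_mem_holds V).mpr ?_), fun h => hV ((hasCM_iff_j_mem_holds V).mpr ?_)⟩ <;>
    rw [h] <;> simp [cmJInvariants]

/-- **On the NON-CM rows of crux 19606 — the domain of `stub_etaMC_nonCM_uncongruent` — «no CM anchor» depends only on `j`.** For `V`
non-CM and `V'` with `j(V') = j(V)`, both globally minimal and good at the prime `p ≠ 2`: the negated existential of the stub holds for `V`
iff it holds for `V'` (§5 with `j ∉ {0, 1728}` discharged by `¬ V.HasCM`); `V'` is non-CM as well (`hasCM_iff_of_j_eq`).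
[cite: SilvermanAEC2009, X.5 Prop. 5.4 and Cor. 5.4.1] [cite: SilvermanAdvancedTopics1994, App. A §3] -/
theorem not_exists_cmAnchor_iff_of_j_eq_of_not_hasCM (V V' : WeierstrassCurve ℚ) [V.IsElliptic] [V.IsGloballyMinimal]
    [V'.IsElliptic] [V'.IsGloballyMinimal] (p : ℕ) [Fact p.Prime] (hp2 : p ≠ 2) (hV : ¬ V.HasCM) (hj : V'.j = V.j)
    (hgood : V.HasGoodReductionAtPrime p) (hgood' : V'.HasGoodReductionAtPrime p) :
    ((¬ ∃ (A : WeierstrassCurve ℚ) (_ : A.IsElliptic) (_ : A.IsGloballyMinimal),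
        A.HasCM ∧ A.HasGoodReductionAtPrime p ∧ A.frobeniusTrace p = 0 ∧ ModPCongruent A V p) ↔
      ¬ ∃ (A : WeierstrassCurve ℚ) (_ : A.IsElliptic) (_ : A.IsGloballyMinimal),
        A.HasCM ∧ A.HasGoodReductionAtPrime p ∧ A.frobeniusTrace p = 0 ∧ ModPCongruent A V' p) ∧ ¬ V'.HasCM := by
  obtain ⟨h0, h1728⟩ := j_ne_zero_and_ne_1728_of_not_hasCM V hV
  exact ⟨not_exists_cmAnchor_iff_of_j_eq V V' p hp2 hj h0 h1728 hgood hgood', fun h => hV ((hasCM_iff_of_j_eq hj).mp h)⟩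

/-- **Row transport by `j` on the non-CM rows**: `V` a non-CM row at `p ≠ 2`, `V'` globally minimal, good at `p`, `j(V') = j(V)` ⟹ `V'` is a
non-CM row (`a_p(V') = 0`, tower not onto, `¬ V'.HasCM`). [cite: SilvermanAEC2009, X.5 Prop. 5.4, VII.5 Prop. 5.1] [cite: Knapp1993, Prop. 12.10] -/
theorem row_of_j_eq_of_not_hasCM (V V' : WeierstrassCurve ℚ) [V.IsElliptic] [V.IsGloballyMinimal] [V'.IsElliptic]
    [V'.IsGloballyMinimal] (p : ℕ) [Fact p.Prime] (hp2 : p ≠ 2) (hV : ¬ V.HasCM) (hj : V'.j = V.j)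
    (hgood : V.HasGoodReductionAtPrime p) (hgood' : V'.HasGoodReductionAtPrime p) (hap : V.frobeniusTrace p = 0)
    (hns : ¬ ∀ m : ℕ, V.HasSurjectiveModNGaloisRep (p ^ m : ℕ)) :
    V'.frobeniusTrace p = 0 ∧ (¬ ∀ m : ℕ, V'.HasSurjectiveModNGaloisRep (p ^ m : ℕ)) ∧ ¬ V'.HasCM := by
  obtain ⟨h0, h1728⟩ := j_ne_zero_and_ne_1728_of_not_hasCM V hV
  obtain ⟨hap', hns'⟩ := row_of_j_eq V V' p hp2 hj h0 h1728 hgood hgood' hap hns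
  exact ⟨hap', hns', fun h => hV ((hasCM_iff_of_j_eq hj).mp h)⟩

/-! ## §7 (appended, k8eta-c2 g15) Complement: a curve `p`-congruent to a CM curve is never tower-onto -/

/-- **CM-congruent curves are never tower-onto.** If `A` is CM and `A[p] ≅ V[p]` as `Γ_ℚ`-modules (`ModPCongruent A V p`) at an odd prime
`p`, then the `p`-adic tower of `V` is NOT onto: `ρ̄_{V,p}` onto would transport along the (inverse) congruence to `ρ̄_{A,p}` onto
(`GaloisImage.hasSurjectiveModNGaloisRep_of_torsionIso`), impossible for a CM curve at an odd prime (`not_hasSurjectiveModNGaloisRep_of_hasCM`).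
So on the CM-transfer branch of skeleton v7 the displayed row hypothesis «tower not onto» follows from the congruence (kernel congruences at
`p = 5`: g8's `EtaModFiveCongruenceRecords.modPCongruent_twist5_*`; at `p = 7` the anchor `y² = x³ + 3x` of the row `x = −3/7` is certified only
numerically, Kraus–Oesterlé, kit j308771). [cite: Zywina2015, Prop. 1.14] [cite: Serre1972, §4.5] -/
theorem not_forall_hasSurjectiveModNGaloisRep_pow_of_cmCongruent (V : WeierstrassCurve ℚ) [V.IsElliptic] (p : ℕ) [hp : Fact p.Prime]
    (hp2 : p ≠ 2) {A : WeierstrassCurve ℚ} [A.IsElliptic] (hCM : A.HasCM) (hAV : ModPCongruent A V p) :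
    ¬ ∀ m : ℕ, V.HasSurjectiveModNGaloisRep (p ^ m : ℕ) := by
  intro h
  have h1 : V.HasSurjectiveModNGaloisRep p := by simpa using h 1
  obtain ⟨e, he⟩ := hAV
  have hA : A.HasSurjectiveModNGaloisRep p :=
    Summit.BirchSwinnertonDyer.Rank1Residual.GaloisImage.hasSurjectiveModNGaloisRep_of_torsionIso e.symm (fun σ Q => by
      apply e.injective
      rw [he, e.apply_symm_apply, e.apply_symm_apply]) h1
  exact A.not_hasSurjectiveModNGaloisRep_of_hasCM hCM hp.out hp2 hA

/-- **Packaged: a CM-congruent curve is a row.** `V` globally minimal, good at the odd prime `p` with `a_p(V) = 0`, and `p`-congruent to a CM curve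
⟹ `V` satisfies the three row hypotheses of crux 19606 (the third by the previous theorem). Bookkeeping. [cite: Zywina2015, Prop. 1.14] -/
theorem row_of_cmCongruent (V : WeierstrassCurve ℚ) [V.IsElliptic] [V.IsGloballyMinimal] (p : ℕ) [Fact p.Prime] (hp2 : p ≠ 2)
    (hgood : V.HasGoodReductionAtPrime p) (hap : V.frobeniusTrace p = 0)
    {A : WeierstrassCurve ℚ} [A.IsElliptic] (hCM : A.HasCM) (hAV : ModPCongruent A V p) :
    V.HasGoodReductionAtPrime p ∧ V.frobeniusTrace p = 0 ∧ ¬ ∀ m : ℕ, V.HasSurjectiveModNGaloisRep (p ^ m : ℕ) :=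
  ⟨hgood, hap, not_forall_hasSurjectiveModNGaloisRep_pow_of_cmCongruent V p hp2 hCM hAV⟩

/-! ## §8 (appended, k8eta-c2 g15) The negated existential forces non-CM -/

/-- Mod-`p` congruence is reflexive (the identity of `W[p]` is `Γ_ℚ`-equivariant). [folklore] -/
theorem modPCongruent_refl (W : WeierstrassCurve ℚ) (p : ℕ) : ModPCongruent W W p :=
  ⟨AddEquiv.refl _, fun _ _ => rfl⟩

/-- **A curve in the locus of `stub_etaMC_nonCM_uncongruent` is non-CM.** If `V` is globally minimal, good at `p` with `a_p(V) = 0`, and NO globally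
minimal CM curve good at `p` with `a_p = 0` is `p`-congruent to `V`, then `V` is not CM — otherwise `V` itself would be such an anchor
(`modPCongruent_refl`). So each kernel record of the stub's locus also discharges the stub's domain hypothesis `¬ V.HasCM` for its curve. [folklore] -/
theorem not_hasCM_of_not_exists_cmAnchor (V : WeierstrassCurve ℚ) [hVe : V.IsElliptic] [hVm : V.IsGloballyMinimal] (p : ℕ)
    [Fact p.Prime] (hgood : V.HasGoodReductionAtPrime p) (hap : V.frobeniusTrace p = 0)
    (hV : ¬ ∃ (A : WeierstrassCurve ℚ) (_ : A.IsElliptic) (_ : A.IsGloballyMinimal),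
        A.HasCM ∧ A.HasGoodReductionAtPrime p ∧ A.frobeniusTrace p = 0 ∧ ModPCongruent A V p) :
    ¬ V.HasCM := fun hCM =>
  hV ⟨V, hVe, hVm, hCM, hgood, hap, modPCongruent_refl V p⟩

end Summit.BirchSwinnertonDyer.BirchSwinnertonDyer.Theorems.EtaCartanField

end
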